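import Literature.Computability.QuantumComplexity.CWrapFamily
import Literature.Computability.QuantumComplexity.CWrapExpr
import Literature.Computability.QuantumComplexity.CWrapPost
import Literature.Computability.QuantumComplexity.CleanBlockDesc
import Literature.Computability.QuantumComplexity.RevMultiplexGen
import Literature.Computability.QuantumComplexity.SwapDesc
import Literature.Computability.Cryptography.QuantumCircuitDescFP
import Literature.Computability.Complexity.CountingHierarchyProofs
import HarnessLib

/-!
# Classical wrapping inside quantum search, VI: the wrapped family is uniform

Trunk `CryptoQuantFine`; sixth file of the construction discharging
`Literature.Computability.Cryptography.isQSolvable_classicalWrap` (plan in `CWrapLayout.lean`):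
**`CWrap.family_isUniform`** — if the given family is polynomial-time uniform, so is the wrapped
family. By `QCircuitFamily.isUniform_of_descFn_mem_FP` it suffices that the description
`1ⁿ ↦ ⟨bin n, ⟨1^{anc n}, encode (circ n)⟩⟩` is in `FP`; `encode (circ n)` is the
concatenation (`RevDesc.encode_eq_flatMap`) of

* the description bits of stage 1 — the garbage-free block of `h` (`CleanBlockDesc.lean`), the
  flags and the router (generators of `RevMultiplexGen.lean` at the counter expressions of
  `CWrapExpr.lean`, rendered by `GStmt.render_out_mem_FP`);
* for every `ℓ ≤ L(n)`: the swap of the front window with block `ℓ` (printed at the string level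
  by `SwapDesc.swapDescFn`), the description of `F.circ ℓ` *verbatim* (the body of the given
  family's description function, `QCircuitFamily.descFn ∈ FP`), and the swap again — folded by
  the counted concatenation fold of `FoldBricks.lean`;
* the description bits of stage 2 — the garbage-free block of `gWrap g` and the output swaps.

(Arora–Barak 2009, §6.2 Def. 6.12 and Remark 6.7; Bernstein–Vazirani 1997, §8; Shor 1997, §2
p. 7: "the design of the gate array be produced by a polynomial-time (classical) computation".)

## References

* S. Arora, B. Barak, *Computational Complexity: A Modern Approach*, CUP 2009, §6.2, Remark 6.7.
* E. Bernstein, U. Vazirani, *Quantum complexity theory*, SIAM J. Comput. 26 (1997), §8.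
* P. W. Shor, SIAM J. Comput. 26 (1997), §2 p. 7.
-/

noncomputable section

namespace Literature.Computability.QuantumComplexity

namespace CWrap

open _root_.Computability Polynomial Complexity Complexity.Brick Plumb RevDesc RevSim RevClean Cryptography RevMux
  Complexity.GExpr

variable (P : Params)

/-! ### Stage descriptions are program descriptions -/

/-- The description bits of a clamped compiled program are the `opBits` of the program.
[cite: AroraBarak2009, §6.1 (descriptions of circuits)] -/
theorem flatMap_gateEnc_clamp (n : ℕ) (ops : List (ClOp ℕ)) (hlt : ∀ op ∈ ops, ∀ i ∈ wiresOf op, i < n + anc P n)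
    (hwf : ∀ op ∈ ops, op.WF) :
    (revCompile (clamp P n ops hlt hwf)).flatMap gateEnc = ops.flatMap opBits :=
  flatMap_gateEnc_revCompile_toRevList (widthG_pos P n) ops hlt _

/-- Stage 1 describes as `prog1`. [folklore] -/
theorem flatMap_gateEnc_stage1 (n : ℕ) : (stage1 P n).flatMap gateEnc = (prog1 P n).flatMap opBits :=
  flatMap_gateEnc_clamp P n _ _ _

/-- Stage 2 describes as `prog2`. [folklore] -/
theorem flatMap_gateEnc_stage2 (n : ℕ) : (stage2 P n).flatMap gateEnc = (prog2 P n).flatMap opBits :=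
  flatMap_gateEnc_clamp P n _ _ _

/-- The conjugating swap describes as `progConj` (for `ℓ ≤ L(n)`). [folklore] -/
theorem flatMap_gateEnc_conjGates {n ℓ : ℕ} (hℓ : ℓ ≤ Lh P.toLayout n) :
    (conjGates P n ℓ).flatMap gateEnc = (progConj P n ℓ).flatMap opBits := by
  unfold conjGates; rw [dif_pos hℓ]; exact flatMap_gateEnc_clamp P n _ _ _

/-- Placing a gate on the front wires does not change its description. [folklore] -/
theorem gateEnc_mapWiresGate_castLEEmb {k N : ℕ} (h : k ≤ N) (g : QGate cliffordT k) :
    gateEnc (mapWiresGate (Fin.castLEEmb h) g) = gateEnc g := by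
  cases g with
  | gate s emb => simp [mapWiresGate, gateEnc, QGate.encode]
  | oracle m emb => simp [mapWiresGate, gateEnc, QGate.encode]

/-- The copy describes as the given circuit, verbatim (for `ℓ ≤ L(n)`). [cite: AroraBarak2009, §6.2 (a circuit for each input length, hard-wired)] -/
theorem flatMap_gateEnc_copyGates {n ℓ : ℕ} (hℓ : ℓ ≤ Lh P.toLayout n) :
    (copyGates P n ℓ).flatMap gateEnc = (P.F.circ ℓ).encode := by
  unfold copyGates
  rw [dif_pos hℓ, show (P.F.circ ℓ).encode = QCircuit.encode (⟨(P.F.circ ℓ).gates⟩ : QCircuit cliffordT _) from rfl,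
    encode_eq_flatMap]
  simp only [mapWires, List.flatMap_map, gateEnc_mapWiresGate_castLEEmb]

/-- The body of the description function of a family is the code of its circuit. [folklore] -/
theorem sndF_sndF_descFn {G : QGateSet} [Encodable G.Op] (F : QCircuitFamily G) (z : List Bool) :
    sndF (sndF (F.descFn z)) = (F.circ z.length).encode := by
  rw [QCircuitFamily.descFn_eq]; simp

/-! ### Expressions at a tableau length; the remaining sizes -/

/-- Substitute the expression `NE` for the tableau length `xn`. [folklore] -/
def atE (NE E : GE) : GE := E.subst (substN NE)

/-- Value of `atE`. [folklore] -/
@[simp] theorem eval_atE (NE E : GE) (env : GV → ℕ) : (atE NE E).eval env = E.eval (Function.update env .xn (NE.eval env)) := by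
  rw [atE, GExpr.eval_subst, eval_substN]

/-- `atE NE E` mentions only `uu` when `NE` does and `E` mentions only `xn`. [folklore] -/
theorem inUU_atE {NE E : GE} (hNE : InUU NE) (hE : ∀ x ∈ E.fv, x = GV.xn) : InUU (atE NE E) := by
  intro x hx
  obtain ⟨y, hy, hxy⟩ := fv_subst_sub _ E x hx
  have := hE y hy; subst this
  simpa [substN] using hNE x hxy

/-- The output wire of cell `j` of the post-processor block, as an expression. [folklore] -/
def tWgE (jE : GE) : GE :=
  .add (atE (nGE P.toLayout) (.add (.var .xn) (ancNE P.Mg.tm P.eg)))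
    (.add (.mul jE (.const (A₁ P.Mg))) (.const (eA P.Mg (symTrue P.Mg))))

/-- Value of `tWgE`. [folklore] -/
@[simp] theorem eval_tWgE (jE : GE) (env : GV → ℕ) : (tWgE P jE).eval env = tWg P (env .uu) (jE.eval env) := by
  simp only [tWgE, GExpr.eval, eval_atE, eval_ancNE, Function.update_self, eval_nGE]
  rfl

/-- `Pg` as an expression. [folklore] -/
def PgE : GE := atE (nGE P.toLayout) (JJE P.eg P.Mg)

/-- Value of `PgE`. [folklore] -/
@[simp] theorem eval_PgE (env : GV → ℕ) : (PgE P).eval env = Pg P (env .uu) := by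
  simp only [PgE, eval_atE, eval_JJE, Function.update_self, eval_nGE]
  rfl

/-- `PgE` mentions only `uu`. [folklore] -/
theorem inUU_PgE : InUU (PgE P) := inUU_atE inUU_nGE (fv_JJE _ _)

/-! ### Stage 1 describes in polynomial time -/

/-- The block of `h` describes in polynomial time. [folklore] -/
theorem progH_desc_mem_FP : (fun z : List Bool => (progH P z.length).flatMap opBits) ∈ FP := by
  have h := flatMap_opBits_cleanOps_mem_FP (e := P.eh) (M := P.Mh) (.var .uu) (.var .uu) [] (fun x hx => by simpa [GExpr.fv] using hx)
    (fun p hp => by simp at hp) (fun _ => []) (fun u => by simp [notsV]) (fun u => by simp)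
  refine (congrArg (· ∈ FP) (funext fun z => ?_)).mpr h
  simp [progH, GExpr.eval]

/-- The flags describe in polynomial time. [folklore] -/
theorem progFlags_desc_mem_FP : (fun z : List Bool => (progFlags P z.length).flatMap opBits) ∈ FP := by
  have hx : GV.uu ∉ (RevMuxGen.flagsG (empE P.toLayout) (flagWE P.toLayout) (LhE P.toLayout)).loopVars := fun h => by
    rcases RevMuxGen.loopVars_flagsG _ _ _ _ h with h | h <;> exact absurd h (by decide)
  have h := GStmt.render_out_mem_FP _ GV.uu hx (RevMuxGen.noReuse_flagsG _ _ _)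
  refine (congrArg (· ∈ FP) (funext fun z => ?_)).mpr h
  rw [RevMuxGen.out_flagsG (emp := empW P.toLayout) (flag := flagW P.toLayout) (fun a env => eval_empE a env) (fun a env => eval_flagWE a env),
    render_flatMap_opToks_nil, eval_LhE, GenProg.initEnv_self]
  rfl

/-- The router describes in polynomial time. [folklore] -/
theorem progRoute_desc_mem_FP : (fun z : List Bool => (progRoute P z.length).flatMap opBits) ∈ FP := by
  have hx : GV.uu ∉ (RevMuxGen.routeG (flagWE P.toLayout) (tWhE P.toLayout) (blockWE P.toLayout) (LhE P.toLayout)).loopVars := fun h => by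
    rcases RevMuxGen.loopVars_routeG _ _ _ _ _ h with h | h | h <;> exact absurd h (by decide)
  have h := GStmt.render_out_mem_FP _ GV.uu hx (RevMuxGen.noReuse_routeG _ _ _ _)
  refine (congrArg (· ∈ FP) (funext fun z => ?_)).mpr h
  rw [RevMuxGen.out_routeG (flag := flagW P.toLayout) (src := tWh P.toLayout) (dst := blockW P.toLayout)
      (fun a env => eval_flagWE a env) (fun a env => eval_tWhE a env) (fun a b env => eval_blockWE a b env),
    render_flatMap_opToks_nil, eval_LhE, GenProg.initEnv_self]
  rfl

/-- **Stage 1 describes in polynomial time.** [cite: AroraBarak2009, §6.2 Def. 6.12 and Remark 6.7 (descriptions printed in polynomial time)] -/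
theorem stage1_desc_mem_FP : (fun z : List Bool => (stage1 P z.length).flatMap gateEnc) ∈ FP := by
  have h := append_mem_FP (progH_desc_mem_FP P) (append_mem_FP (progFlags_desc_mem_FP P) (progRoute_desc_mem_FP P))
  refine (congrArg (· ∈ FP) (funext fun z => ?_)).mpr h
  rw [flatMap_gateEnc_stage1, prog1, List.flatMap_append, List.flatMap_append]

/-! ### Stage 2 describes in polynomial time -/

/-- The suffix gadget of the post-processor block: one `NOT` at `D`, and `2n` `NOT`s from `D + 2`.
[folklore] -/
theorem notsV_D_vg (Q : Layout) (n : ℕ) :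
    notsV (D Q n) (vg n) = [ClOp.not (D Q n + 0)] ++ (List.range (2 * n)).map fun i => ClOp.not (D Q n + 2 + i) := by
  rw [vg, show ([true, false] : List Bool) = [true] ++ [false] from rfl, List.append_assoc, notsV_append, notsV_append,
    show ([true] : List Bool) = List.replicate 1 true from rfl, notsV_replicate_true, notsV_singleton_false,
    notsV_replicate_true]
  simp

/-- The block of the post-processor describes in polynomial time. [folklore] -/
theorem progG_desc_mem_FP : (fun z : List Bool => (progG P z.length).flatMap opBits) ∈ FP := by
  have h := flatMap_opBits_cleanOps_mem_FP (e := P.eg) (M := P.Mg) (DE P.toLayout) (nGE P.toLayout)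
    [(DE P.toLayout, .const 1), (.add (DE P.toLayout) (.const 2), .mul (.const 2) (.var .uu))] inUU_nGE
    (fun p hp => by
      simp only [List.mem_cons, List.not_mem_nil, or_false] at hp
      rcases hp with rfl | rfl
      · exact inUU_DE
      · intro x hx
        simp only [GExpr.fv, List.mem_append, List.not_mem_nil, or_false] at hx
        exact inUU_DE x hx)
    vg (fun u => by
      rw [eval_DE]
      simp only [envU, GenProg.initEnv_self, List.flatMap_cons, List.flatMap_nil, List.append_nil, GExpr.eval, eval_DE]
      rw [notsV_D_vg]
      simp)
    (fun u => by simp [nG, GenProg.initEnv])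
  refine (congrArg (· ∈ FP) (funext fun z => ?_)).mpr h
  simp [progG, GenProg.initEnv]

/-- The output swaps describe in polynomial time. [folklore] -/
theorem progOut_desc_mem_FP : (fun z : List Bool => (progOut P z.length).flatMap opBits) ∈ FP := by
  have hx : GV.uu ∉ (RevMuxGen.swapsG (tWgE P) (fun j => j) (PgE P)).loopVars := fun h => by
    rcases RevMuxGen.loopVars_swapsG _ _ _ _ h with h | h <;> exact absurd h (by decide)
  have h := GStmt.render_out_mem_FP _ GV.uu hx (RevMuxGen.noReuse_swapsG _ _ _)
  refine (congrArg (· ∈ FP) (funext fun z => ?_)).mpr h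
  rw [RevMuxGen.out_swapsG (a := tWg P) (b := fun _ j => j) (fun c env => eval_tWgE P c env) (fun c env => rfl),
    render_flatMap_opToks_nil, eval_PgE, GenProg.initEnv_self]
  simp only [progOut, outPairs, swapOps, List.flatMap_map]

/-- **Stage 2 describes in polynomial time.** [cite: AroraBarak2009, §6.2 Def. 6.12 and Remark 6.7 (descriptions printed in polynomial time)] -/
theorem stage2_desc_mem_FP : (fun z : List Bool => (stage2 P z.length).flatMap gateEnc) ∈ FP := by
  have h := append_mem_FP (progG_desc_mem_FP P) (progOut_desc_mem_FP P)
  refine (congrArg (· ∈ FP) (funext fun z => ?_)).mpr h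
  rw [flatMap_gateEnc_stage2, prog2, List.flatMap_append]

/-! ### The quantum stage describes in polynomial time -/

section StageQ

/-- The context field of the piece: `z = 1ⁿ` (as `⟨⟨z, ruler⟩, 1^ℓ⟩ ↦ z`). [folklore] -/
def zOf : List Bool → List Bool := fstF ∘ fstF

/-- The swap piece: the description of the swap of the front window with block `ℓ`, from
`⟨⟨1ⁿ, ruler⟩, 1^ℓ⟩` (offset `baseB n + ℓ · Pw n` in binary, `1^{Pw n}`). [folklore] -/
def swF : List Bool → List Bool :=
  SwapDesc.swapDescFn ∘ fanoutFn
    (addFn ∘ fanoutFn (lenBinF ∘ polyFn (baseBPoly P.toLayout) ∘ zOf)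
      (prodFn ∘ fanoutFn (lenBinF ∘ sndF) (lenBinF ∘ polyFn (PwPoly P.toLayout) ∘ zOf)))
    (polyFn (PwPoly P.toLayout) ∘ zOf)

/-- The copy piece: the body of the given family's description at `1^ℓ`. [folklore] -/
def copyF : List Bool → List Bool := sndF ∘ sndF ∘ P.F.descFn ∘ sndF

/-- The piece of index `ℓ`: swap, copy, swap. [folklore] -/
def pieceQ : List Bool → List Bool := appF ∘ fanoutFn (swF P) (appF ∘ fanoutFn (copyF P) (swF P))

/-- `swF` computes the description of the conjugating swap. [folklore] -/
theorem swF_apply (z r : List Bool) (ℓ : ℕ) :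
    swF P (boolPair (boolPair z r) (ones ℓ)) = (progConj P z.length ℓ).flatMap opBits := by
  have h : swF P (boolPair (boolPair z r) (ones ℓ)) =
      SwapDesc.swapDescFn (boolPair (encodeNat (baseB P.toLayout z.length + ℓ * Pw P.toLayout z.length)) (ones (Pw P.toLayout z.length))) := by
    simp [swF, zOf, fanoutFn_apply, ones]
  rw [h, SwapDesc.swapDescFn_apply]
  rfl

/-- `copyF` computes the description of the copy (for `ℓ ≤ L(n)`). [folklore] -/
theorem copyF_apply (z r : List Bool) {ℓ : ℕ} (hℓ : ℓ ≤ Lh P.toLayout z.length) :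
    copyF P (boolPair (boolPair z r) (ones ℓ)) = (copyGates P z.length ℓ).flatMap gateEnc := by
  rw [flatMap_gateEnc_copyGates P hℓ, copyF]
  simp only [Function.comp_apply, sndF_boolPair, sndF_sndF_descFn]
  have key : ∀ m, m = ℓ → (P.F.circ m).encode = (P.F.circ ℓ).encode := by rintro m rfl; rfl
  exact key _ (by simp [ones])

/-- The piece of index `ℓ ≤ L(n)` is the description of swap–copy–swap. [folklore] -/
theorem pieceQ_apply (z r : List Bool) {ℓ : ℕ} (hℓ : ℓ ≤ Lh P.toLayout z.length) :
    pieceQ P (boolPair (boolPair z r) (ones ℓ)) =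
      (conjGates P z.length ℓ ++ (copyGates P z.length ℓ ++ conjGates P z.length ℓ)).flatMap gateEnc := by
  rw [List.flatMap_append, List.flatMap_append, flatMap_gateEnc_conjGates P hℓ, ← copyF_apply P z r hℓ, ← swF_apply P z r ℓ]
  simp [pieceQ, fanoutFn_apply]

/-- `swF ∈ FP`. [folklore] -/
theorem swF_mem_FP : swF P ∈ FP := by
  have hz : zOf ∈ FP := comp_mem_FP fstF_mem_FP fstF_mem_FP
  exact comp_mem_FP SwapDesc.swapDescFn_mem_FP (fanoutFn_mem_FP
    (comp_mem_FP addFn_mem_FP (fanoutFn_mem_FP (comp_mem_FP lenBinF_mem_FP (comp_mem_FP (polyFn_mem_FP _) hz))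
      (comp_mem_FP prodFn_mem_FP (fanoutFn_mem_FP (comp_mem_FP lenBinF_mem_FP sndF_mem_FP)
        (comp_mem_FP lenBinF_mem_FP (comp_mem_FP (polyFn_mem_FP _) hz))))))
    (comp_mem_FP (polyFn_mem_FP _) hz))

/-- `copyF ∈ FP` for a uniform family. [folklore] -/
theorem copyF_mem_FP (hU : P.F.IsUniform) : copyF P ∈ FP :=
  comp_mem_FP sndF_mem_FP (comp_mem_FP sndF_mem_FP (comp_mem_FP (QCircuitFamily.descFn_mem_FP_of_isUniform hU) sndF_mem_FP))

/-- `pieceQ ∈ FP` for a uniform family. [folklore] -/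
theorem pieceQ_mem_FP (hU : P.F.IsUniform) : pieceQ P ∈ FP :=
  comp_mem_FP appF_mem_FP (fanoutFn_mem_FP (swF_mem_FP P) (comp_mem_FP appF_mem_FP (fanoutFn_mem_FP (copyF_mem_FP P hU) (swF_mem_FP P))))

/-- `D(n)` as a polynomial. [folklore] -/
def DPoly (Q : Layout) : Polynomial ℕ := baseBPoly Q + (LhPoly Q + 1) * PwPoly Q

/-- Value of `DPoly`. [folklore] -/
@[simp] theorem eval_DPoly (Q : Layout) (n : ℕ) : (DPoly Q).eval n = D Q n := by simp [DPoly, D]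

variable (ps pd : Polynomial ℕ)

/-- The ruler polynomial: room for the rounds and for every piece. [folklore] -/
def rulerPoly : Polynomial ℕ :=
  LhPoly P.toLayout + 1 + (C 2 * ps.comp (C 2 * DPoly P.toLayout + C 2 + PwPoly P.toLayout) + pd.comp (LhPoly P.toLayout))

/-- The initial record of the fold: `⟨⟨z, ruler⟩, ⟨bin (L(n)+1), ⟨1⁰, []⟩⟩⟩`. [folklore] -/
def initQ : List Bool → List Bool :=
  fanoutFn (fanoutFn (fun z => z) (polyFn (rulerPoly P ps pd))) (fanoutFn (lenBinF ∘ polyFn (LhPoly P.toLayout + 1)) (fun _ => boolPair [] []))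

/-- **The description of the quantum stage** as a string function: fold the pieces `ℓ ≤ L(n)`.
[cite: AroraBarak2009, §1.3 (bounded loops)] -/
def sqF : List Bool → List Bool := sndPow 2 ∘ foldLoop appF (clipF 1 (pieceQ P)) X ∘ initQ P ps pd

/-- `sqF ∈ FP`. [folklore] -/
theorem sqF_mem_FP (hU : P.F.IsUniform) : sqF P ps pd ∈ FP :=
  comp_mem_FP (sndPow_mem_FP 2) (comp_mem_FP (foldLoop_clipF_mem_FP 1 appF_mem_FP length_appF_le (pieceQ_mem_FP P hU) X)
    (fanoutFn_mem_FP (fanoutFn_mem_FP (PolyTimeComputable.id _) (polyFn_mem_FP _))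
      (fanoutFn_mem_FP (comp_mem_FP lenBinF_mem_FP (polyFn_mem_FP _)) (const_mem_FP _))))

/-- A `flatMap` over a range is a `ccat`. [folklore] -/
theorem flatMap_range_eq_ccat (f : ℕ → List Bool) : ∀ k : ℕ, (List.range k).flatMap f = ccat f k
  | 0 => rfl
  | k + 1 => by rw [List.range_succ, List.flatMap_append, flatMap_range_eq_ccat f k, ccat_succ]; simp

/-- **The fold computes the description of the quantum stage**, provided the ruler bounds the
pieces: `|swapDescFn v| ≤ ps |v|` and `|descFn u| ≤ pd |u|`. [folklore] -/
theorem sqF_apply (hps : ∀ v, (SwapDesc.swapDescFn v).length ≤ ps.eval v.length)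
    (hpd : ∀ u, (P.F.descFn u).length ≤ pd.eval u.length) (z : List Bool) :
    sqF P ps pd z = (stageQ P z.length).flatMap gateEnc := by
  set n := z.length with hn
  set ctx := boolPair z (ones ((rulerPoly P ps pd).eval n)) with hctx
  have hinit : initQ P ps pd z = boolPair ctx (boolPair (encodeNat (Lh P.toLayout n + 1)) (boolPair (ones 0) [])) := by
    simp [initQ, fanoutFn_apply, hctx, hn, ones]
  have hrounds : Lh P.toLayout n + 1 ≤ (X : Polynomial ℕ).eval ctx.length := by
    rw [eval_X, hctx, length_boolPair]
    have : Lh P.toLayout n + 1 ≤ (rulerPoly P ps pd).eval n := by simp [rulerPoly]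
    simp [ones]; omega
  -- the pieces are within the ruler
  have hpiece : ∀ j, 0 ≤ j → j < 0 + (Lh P.toLayout n + 1) →
      (pieceQ P (boolPair ctx (ones j))).length ≤ 1 * (ctx.length + 1) := by
    intro j _ hj
    have hjL : j ≤ Lh P.toLayout n := by omega
    rw [hctx, pieceQ_apply P z _ (by rw [← hn]; exact hjL), List.flatMap_append, List.flatMap_append, List.length_append,
      List.length_append, flatMap_gateEnc_conjGates P (by rw [← hn]; exact hjL), flatMap_gateEnc_copyGates P (by rw [← hn]; exact hjL),
      ← hn]
    -- the swap part
    have hsw : ((progConj P n j).flatMap opBits).length ≤ ps.eval (2 * D P.toLayout n + 2 + Pw P.toLayout n) := by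
      rw [← swF_apply P z (ones ((rulerPoly P ps pd).eval n)) j]
      have h := hps (boolPair (encodeNat (baseB P.toLayout n + j * Pw P.toLayout n)) (ones (Pw P.toLayout n)))
      have e : swF P (boolPair (boolPair z (ones ((rulerPoly P ps pd).eval n))) (ones j)) =
          SwapDesc.swapDescFn (boolPair (encodeNat (baseB P.toLayout n + j * Pw P.toLayout n)) (ones (Pw P.toLayout n))) := by
        simp [swF, zOf, fanoutFn_apply, ones, hn]
      rw [e]
      refine h.trans (TM2Iter.eval_mono ps ?_)
      rw [length_boolPair]
      have hb : (encodeNat (baseB P.toLayout n + j * Pw P.toLayout n)).length ≤ D P.toLayout n := by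
        refine (Complexity.length_encodeNat_le_self _).trans ?_
        have h3 : (Lh P.toLayout n + 1) * Pw P.toLayout n = Lh P.toLayout n * Pw P.toLayout n + Pw P.toLayout n := by ring
        have h4 : j * Pw P.toLayout n ≤ Lh P.toLayout n * Pw P.toLayout n := Nat.mul_le_mul_right _ hjL
        unfold D; omega
      simp [ones]; omega
    -- the copy part
    have hcp : (P.F.circ j).encode.length ≤ pd.eval (Lh P.toLayout n) := by
      have h := hpd (ones j)
      rw [QCircuitFamily.descFn_eq, length_boolPair, length_boolPair] at h
      have : (ones j).length = j := by simp [ones]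
      rw [this] at h
      exact le_trans (by omega) ((TM2Iter.eval_mono pd hjL))
    rw [length_boolPair]
    have hr : (rulerPoly P ps pd).eval n = Lh P.toLayout n + 1 + (2 * ps.eval (2 * D P.toLayout n + 2 + Pw P.toLayout n) + pd.eval (Lh P.toLayout n)) := by
      simp [rulerPoly]
    simp only [ones, List.length_replicate, one_mul]
    omega
  rw [sqF, Function.comp_apply, Function.comp_apply, hinit, foldLoop_apply appF (clipF 1 (pieceQ P)) hrounds 0 [],
    sndPow_succ_boolPair, sndPow_succ_boolPair, sndPow_zero_boolPair, foldAcc_clipF hpiece, foldAcc_appF, List.nil_append,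
    stageQ, List.flatMap_assoc, flatMap_range_eq_ccat]
  refine ccat_congr fun j hj => ?_
  rw [Nat.zero_add, hctx, pieceQ_apply P z _ (by rw [← hn]; omega), ← hn]

end StageQ

/-! ### The header and the assembly -/

/-- `nG(n)` as a polynomial. [folklore] -/
def nGPoly (Q : Layout) : Polynomial ℕ := DPoly Q + C 2 * X + C 2

/-- Value of `nGPoly`. [folklore] -/
@[simp] theorem eval_nGPoly (Q : Layout) (n : ℕ) : (nGPoly Q).eval n = nG Q n := by simp [nGPoly, nG]; ring

/-- `widthG(n)` as a polynomial. [folklore] -/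
def widthGPoly : Polynomial ℕ := (widthPoly P.eg P.Mg).comp (nGPoly P.toLayout)

/-- Value of `widthGPoly`. [folklore] -/
@[simp] theorem eval_widthGPoly (n : ℕ) : (widthGPoly P).eval n = widthG P n := by
  simp [widthGPoly, eval_comp, widthG]

/-- The ancilla count in unary: `1^{widthG n}` with the first `n` symbols dropped. [folklore] -/
def ancF : List Bool → List Bool := dropFn ∘ fanoutFn (fun z => z) (polyFn (widthGPoly P))

/-- Value of `ancF`. [folklore] -/
theorem ancF_apply (z : List Bool) : ancF P z = unaryEncodeNat (anc P z.length) := by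
  simp only [ancF, Function.comp_apply, fanoutFn_apply, dropFn_boolPair, polyFn_apply, eval_widthGPoly, ones, List.drop_replicate, anc]
  exact (RevDesc.unaryEncodeNat_eq_replicate _).symm

/-- `ancF ∈ FP`. [folklore] -/
theorem ancF_mem_FP : ancF P ∈ FP := comp_mem_FP dropFn_mem_FP (fanoutFn_mem_FP (PolyTimeComputable.id _) (polyFn_mem_FP _))

/-- **The wrapped family is polynomial-time uniform** (if the given family is). [cite: AroraBarak2009, §6.2 Def. 6.12 and Remark 6.7 (descriptions printed in polynomial time)] -/
theorem family_isUniform (hU : P.F.IsUniform) : (family P).IsUniform := by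
  obtain ⟨ps, hps⟩ := exists_poly_length_le_of_mem_FP SwapDesc.swapDescFn_mem_FP
  obtain ⟨pd, hpd⟩ := exists_poly_length_le_of_mem_FP (QCircuitFamily.descFn_mem_FP_of_isUniform hU)
  refine QCircuitFamily.isUniform_of_descFn_mem_FP ?_
  have h := fanoutFn_mem_FP lenBinF_mem_FP (fanoutFn_mem_FP (ancF_mem_FP P)
    (append_mem_FP (stage1_desc_mem_FP P) (append_mem_FP (sqF_mem_FP P ps pd hU) (stage2_desc_mem_FP P))))
  have e : (family P).descFn = fanoutFn lenBinF (fanoutFn (ancF P)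
      (fun z => (stage1 P z.length).flatMap gateEnc ++ (sqF P ps pd z ++ (stage2 P z.length).flatMap gateEnc))) := by
    funext z
    have henc : (circ P z.length).encode = (stage1 P z.length ++ (stageQ P z.length ++ stage2 P z.length)).flatMap gateEnc := by
      unfold circ; exact encode_eq_flatMap _
    rw [fanoutFn_apply, fanoutFn_apply, lenBinF_apply, ancF_apply, sqF_apply P ps pd hps hpd, QCircuitFamily.descFn_eq]
    dsimp only [family_circ, family_ancillas]
    rw [henc, List.flatMap_append, List.flatMap_append]
  rw [e]
  exact h

end CWrap

end Literature.Computability.QuantumComplexity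

end
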